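import Summits.CriticalPhenomena.PercolationContinuityZ3.Theorems.PercNearOneGluingNoHeavyLowerTailSunflowerC1FastCensusPetals
import Summits.CriticalPhenomena.PercolationContinuityZ3.Theorems.PercNearOneGluingNoHeavyLowerTailSunflowerC1FourCoinsChunk1
import Summits.CriticalPhenomena.PercolationContinuityZ3.Theorems.PercNearOneGluingNoHeavyLowerTailSunflowerC1FourCoinsChunk2
import Summits.CriticalPhenomena.PercolationContinuityZ3.Theorems.PercNearOneGluingNoHeavyLowerTailSunflowerC1FourCoinsChunk3
import Summits.CriticalPhenomena.PercolationContinuityZ3.Theorems.PercNearOneGluingNoHeavyLowerTailSunflowerC1FourCoinsChunk4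
import Summits.CriticalPhenomena.PercolationContinuityZ3.Theorems.PercNearOneGluingNoHeavyLowerTailSunflowerC1FourCoinsChunk5
import Summits.CriticalPhenomena.PercolationContinuityZ3.Theorems.PercNearOneGluingNoHeavyLowerTailSunflowerC1FourCoinsChunk6
import HarnessLib

/-!
# `NoHeavyLowerTail` (crux stmt-CriticalPhenomena-4575), abstract sunflower cubic at LAW level:
# **(C1) FOR EVERY THREE-PETAL SUNFLOWER OF UP-SETS ON FOUR COINS, AT EVERY BIAS** — the whole census inside the kernel

Support file (seat `prim-ineq-gen-2` gen 33; `--supports stmt-CriticalPhenomena-4575`; computational: `mem_upFams_four`).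
Memo: run/shared/lean/prim/prim-ineq-gen-2/GLADKOV-SPLITTING-GEN33.md §1–§3.

`c1_fourCoins (F : Sunflower (Fin 4)) (x ∈ [0,1]^4) : c₁c₂c₃ ≤ max(a,b)·(ab − (c₁c₂ + c₁c₃ + c₂c₃))` for the cell masses of the product
measure with biases `x` — gen 32's THEOREM 2 ("(C1) on ≤ 4 coins") with the enumeration now INSIDE the kernel check: the 168 up-sets of
`2^[4]` are enumerated by bit masks (`mem_upFams_four`: complete), every sunflower triple (74 229 of them; one representative per
ordering of the petals, six chunks by core size, …C1FourCoinsChunk1–6) passes the fast canonical-Gladkov-splitting certificate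
`checkFast` (…C1FastCertificate), and `c1_fourCoins_of_chunks` (…C1FastCensusPetals) is the soundness of that census.  In particular the
canonical Gladkov splitting (memo §3) certifies (C1) for ALL four-coin structures.
-/

namespace Summit.CriticalPhenomena.PercolationContinuityZ3.Theorems.SunflowerPartition

namespace SafeCalc

namespace C1Cert

open Finset Bern

/-- **Completeness of the mask enumeration on four coins**: every insert-closed family of subsets of `[4]` is listed (with its key)
in `upFams 4`. (Compiled evaluation over the 65 536 families.) [this work] -/
theorem mem_upFams_four : ∀ V : Finset (Finset (Fin 4)), InsClosed V → (V, famKey V) ∈ upFams 4 := by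
  native_decide

/-- **(C1) ON FOUR COINS, AT EVERY BIAS, FOR EVERY SUNFLOWER**: for every three-petal sunflower of up-sets `F` on `Fin 4` and every
`x ∈ [0,1]^4`, with `a, b, c₁, c₂, c₃` the cell masses of the product measure with biases `x`,
`c₁c₂c₃ ≤ max(a,b)·(ab − (c₁c₂ + c₁c₃ + c₂c₃))`. [this work] -/
theorem c1_fourCoins (F : Sunflower (Fin 4)) (x : Fin 4 → ℝ) (hx : ∀ i, 0 ≤ x i ∧ x i ≤ 1) :
    cellMass F 1 x * cellMass F 2 x * cellMass F 3 x ≤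
      max (cellMass F 4 x) (cellMass F 0 x) *
        (cellMass F 4 x * cellMass F 0 x
          - (cellMass F 1 x * cellMass F 2 x + cellMass F 1 x * cellMass F 3 x + cellMass F 2 x * cellMass F 3 x)) :=
  c1_fourCoins_of_chunks fourCoins_chunk_0_4 fourCoins_chunk_4_5 fourCoins_chunk_5_6 fourCoins_chunk_6_7 fourCoins_chunk_7_8
    fourCoins_chunk_8_17 mem_upFams_four F x hx

end C1Cert

end SafeCalc

end Summit.CriticalPhenomena.PercolationContinuityZ3.Theorems.SunflowerPartition
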